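import Summits.AnomalousDissipation.AnomalousDissipation.Theorems.SolenoidalFractalHomogenisationLagrangianStepSidebandXDefectD1
import HarnessLib

/-!
# K1L_D `LagrangianRenormalisationStepDesign` (stmt-AnomalousDissipation-27980), `stub_D1_V0` (V0 = clause (ii) of
# `WCrossing.D1ExactFamily`), brick T4c-3d (D2/D3 pairings): the slow-variation group and the generic Young split on `Space R`
# (helper; `--kind proof --supports stmt-AnomalousDissipation-27980 --as helper`)

Summits-side helper file of route `SolenoidalFractalHomogenisation` (prover seat `ad-k1l-cellLawV-w1` g6).  Everything proved; no definitions, no named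
facts, no sorry.  For the skeleton `Cruxes/LagrangianRenormalisationStepDesign/Lines/onelevel_V0_energy.lean` (`todo_residual_energy_ineq`):
* **`norm_projX_sum_smul_apply_le`** — `‖projX (Σⱼ ξⱼ • Nⱼ v)‖ ≤ (Σⱼ ‖ξⱼ‖·‖Nⱼ‖)·‖v‖` (the D3 group: `v = ẋ` bounded by `…DefectSmall.norm_slowRHS_le`,
  `‖Nⱼ‖` by `norm_responseExt_le`);
* **`two_real_inner_le_of_weight`** — `2⟪r, v⟫_ℝ ≤ θ·‖r‖² + ‖v‖²/θ` on `Space R` (`θ > 0`): the Young split for the `ℓ²`-small groups D2, D3 and the link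
  part of D1 against the gap `σ‖r‖²`.
NOT a proof of any registered stub, of K1L_D, or of anomalous dissipation; rung F-D1.A0 infrastructure.
-/

set_option linter.dupNamespace false

noncomputable section

namespace Summit.AnomalousDissipation.AnomalousDissipation.Theorems.SolenoidalFractalHomogenisation.LagrangianStep.Sideband

open Set MeasureTheory Complex UnitAddTorus
open scoped InnerProductSpace
open Literature.Analysis Literature.Analysis.FunctionSpaces Literature.Analysis.FunctionSpaces.Torus
open Literature.Analysis.FluidPDE Literature.Analysis.FluidPDE.Torus Literature.Analysis.FluidPDE.LatticeShear

variable {k₀ : ℕ}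

/-- **The slow-variation group**: `‖projX (Σⱼ ξⱼ • Nⱼ v)‖ ≤ (Σⱼ ‖ξⱼ‖·‖Nⱼ‖)·‖v‖`. [cite: SandersVerhulstMurdock2007, Lemma 5.2.7 (linear case)] -/
theorem norm_projX_sum_smul_apply_le {R : ℕ} (n : ℕ) (ℓ : Fin 3 → ℤ) (ξ : Fin k₀ → ℂ)
    (N : Fin k₀ → (EuclideanSpace ℂ (Fin 3) →L[ℝ] Space R)) (v : EuclideanSpace ℂ (Fin 3)) :
    ‖projX n ℓ R (∑ j, ξ j • N j v)‖ ≤ (∑ j, ‖ξ j‖ * ‖N j‖) * ‖v‖ := by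
  refine (norm_projX_le n ℓ _).trans ((norm_sum_le _ _).trans ?_)
  rw [Finset.sum_mul]
  refine Finset.sum_le_sum fun j _ => ?_
  rw [norm_smul, mul_assoc]
  exact mul_le_mul_of_nonneg_left ((N j).le_opNorm v) (norm_nonneg _)

/-- **Young split on `Space R`**: `2⟪r, v⟫_ℝ ≤ θ‖r‖² + ‖v‖²/θ` (`θ > 0`). [folklore] -/
theorem two_real_inner_le_of_weight {R : ℕ} (r v : Space R) {θ : ℝ} (hθ : 0 < θ) :
    2 * ⟪r, v⟫_ℝ ≤ θ * ‖r‖ ^ 2 + ‖v‖ ^ 2 / θ := by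
  have h1 : ⟪r, v⟫_ℝ ≤ ‖r‖ * ‖v‖ := real_inner_le_norm r v
  have hsq : 0 ≤ (θ * ‖r‖ - ‖v‖) ^ 2 / θ := div_nonneg (sq_nonneg _) hθ.le
  have hexp : (θ * ‖r‖ - ‖v‖) ^ 2 / θ = θ * ‖r‖ ^ 2 - 2 * (‖r‖ * ‖v‖) + ‖v‖ ^ 2 / θ := by
    field_simp; ring
  linarith [hsq, hexp]

/-- The same with the absolute value: `2|⟪r, v⟫_ℝ| ≤ θ‖r‖² + ‖v‖²/θ`. [folklore] -/
theorem two_abs_real_inner_le_of_weight {R : ℕ} (r v : Space R) {θ : ℝ} (hθ : 0 < θ) :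
    2 * |⟪r, v⟫_ℝ| ≤ θ * ‖r‖ ^ 2 + ‖v‖ ^ 2 / θ := by
  have h1 : |⟪r, v⟫_ℝ| ≤ ‖r‖ * ‖v‖ := abs_real_inner_le_norm r v
  have hsq : 0 ≤ (θ * ‖r‖ - ‖v‖) ^ 2 / θ := div_nonneg (sq_nonneg _) hθ.le
  have hexp : (θ * ‖r‖ - ‖v‖) ^ 2 / θ = θ * ‖r‖ ^ 2 - 2 * (‖r‖ * ‖v‖) + ‖v‖ ^ 2 / θ := by
    field_simp; ring
  linarith [hsq, hexp]

end Summit.AnomalousDissipation.AnomalousDissipation.Theorems.SolenoidalFractalHomogenisation.LagrangianStep.Sideband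

end
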